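import Mathlib
import Literature.Analysis.FluidPDE.Tao2016AveragedNS.ShiftSetCascadeFlows
import Literature.Analysis.FluidPDE.Tao2016AveragedNS.ShiftSetCascadeFlux
import Summits.NavierStokesRegularity.NavierStokesRegularity.Theorems.TaoLadderRungTwoFlatCertificateGlueCheckerDefectOn
import Summits.NavierStokesRegularity.NavierStokesRegularity.Theorems.TaoLadderRungTwoFlatCertificateGlueCheckerGronwallOn
import Summits.NavierStokesRegularity.NavierStokesRegularity.Theorems.TaoLadderRungTwoFlatCertificateGlueCheckerStepOn
import HarnessLib

/-!
# Certificate glue on a shift set `𝕊`, XXV-i: BOX-REGION TABLES — the Lipschitz table `K` and the input-defect table `δ` of the window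
  field on a per-coordinate WEIGHTED BOX `[lo_c, hi_c]·ω` (the region of glue XIX-g `stepCert_of_plohner_box`), and a Grönwall test with a
  general constant `K` (helper for items stmt-NavierStokesRegularity-22987 `FlatGapCertificatesV2` (crux K_A♭ of route TaoLadderRungTwoFlat)
  and stmt-24295 K_A₂(64); cell harvest/h2-tao-ladder, p1 g15; theory-1 R9 «box region»)

* `wbox`, `gOf`, `boxSup_wbox` — the state box `lo i n = ω i n · lo_{idx}` of dyadic vectors `loD`, `hiD` (weighted coordinates) and its
  magnitude `g_c = max(|lo_c|, |hi_c|)` with `boxSup = ω·g`;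
* `checkLipT` / `pfieldLip_of_checkLipT` — `Σ mag(coefB)·(g_a + g_b) ≤ K` per window target ⇒ `PFieldLipOn ω lo hi K` (glue XV-c);
* `gSupT`, `checkDefectT` / `pinputDefect_of_checkDefectT` — the δ-table with `Ĝ⁺ = ω·g` on the window, `Eb`/`Et` at the edges ⇒ `PInputDefectOn`;
* `checkGronwallK` / `gronwallK_of_check` — `gronwallBound 0 K δ h ≤ A` for any `K > 0` (the box-region `K` replaces `2bR`).

HONEST FRAMING: Tao-type MODEL lattices (Tao 2016 §4/§6 vocabulary, shift-set parametrised); arithmetic soundness lemmas — no certificate data,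
nothing certified, no stub closed, nothing about the Navier–Stokes equations.
-/

-- the sub-problem namespace repeats the summit name by design (D-0017)
set_option linter.dupNamespace false

namespace Summit.NavierStokesRegularity.NavierStokesRegularity.Theorems

open Set Finset Literature.Analysis.FluidPDE Literature.Analysis.FluidPDE.TaoCascade
open Summit.NavierStokesRegularity.NavierStokesRegularity.Theorems.TaylorModelCert

namespace CertificateGlueOn

variable {m : ℕ} {Kb Ka : ℤ}

/-! ### The weighted box -/

/-- Per-coordinate magnitude of the weighted box `[lo_c, hi_c]`. [folklore] -/
def gOf (loD hiD : Array Dyad) (c : ℕ) : Dyad := Dyad.max (Dyad.abs (dgetD loD c)) (Dyad.abs (dgetD hiD c))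

/-- `gOf` is nonnegative. [folklore] -/
theorem gOf_nonneg (loD hiD : Array Dyad) (c : ℕ) : 0 ≤ (gOf loD hiD c).toReal := by
  simp only [gOf, Dyad.toReal_max, Dyad.toReal_abs]; exact le_max_of_le_left (abs_nonneg _)

/-- The state box bound of a weighted box vector: `ω i n · v_{idx(i,n)}` on the window, `0` beyond. [folklore] -/
noncomputable def wbox (Kb Ka : ℤ) (ω : Fin m → ℤ → ℝ) (v : Array Dyad) (i : Fin m) (n : ℤ) : ℝ :=
  if h : -Kb ≤ n ∧ n ≤ Ka then ω i n * (dgetD v (idxOf Kb Ka i n h)).toReal else 0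

/-- `boxSup` of the weighted box is `ω · g` on the window. [folklore] -/
theorem boxSup_wbox {ω : Fin m → ℤ → ℝ} (hω : ∀ i k, 0 < ω i k) (loD hiD : Array Dyad) (i : Fin m) {n : ℤ}
    (h : -Kb ≤ n ∧ n ≤ Ka) :
    boxSup Kb Ka (wbox Kb Ka ω loD) (wbox Kb Ka ω hiD) i n = ω i n * (gOf loD hiD (idxOf Kb Ka i n h)).toReal := by
  unfold boxSup wbox gOf
  rw [if_pos h, dif_pos h, dif_pos h, abs_mul, abs_mul, abs_of_pos (hω i n), Dyad.toReal_max, Dyad.toReal_abs, Dyad.toReal_abs,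
    mul_max_of_nonneg _ _ (hω i n).le]

/-- Rational per-(i,n) magnitude table of the weighted box (`0` beyond the window). [folklore] -/
def gTab (Kb Ka : ℤ) (loD hiD : Array Dyad) (i : Fin m) (n : ℤ) : ℚ :=
  if h : -Kb ≤ n ∧ n ≤ Ka then dyadToRat (gOf loD hiD (idxOf Kb Ka i n h)) else 0

/-! ### The K-table on the weighted box -/

/-- One term of the K-table: `mag(coefB)·(g_{i₁}(a) + g_{i₂}(b))` if both factors are on the window, else `0`. [folklore] -/
def lipTermQ (Kb Ka : ℤ) (coefB : Fin m → ℤ → Fin m → Fin m → ℤ × ℤ × ℤ → IntervalD) (loD hiD : Array Dyad) (i : Fin m) (k : ℤ)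
    (i₁ i₂ : Fin m) (μ : ℤ × ℤ × ℤ) : ℚ :=
  if (-Kb ≤ k - μ.2.2 + μ.1 ∧ k - μ.2.2 + μ.1 ≤ Ka) ∧ (-Kb ≤ k - μ.2.2 + μ.2.1 ∧ k - μ.2.2 + μ.2.1 ≤ Ka) then
    dyadToRat (IntervalD.mag (coefB i k i₁ i₂ μ)) *
      (gTab Kb Ka loD hiD i₁ (k - μ.2.2 + μ.1) + gTab Kb Ka loD hiD i₂ (k - μ.2.2 + μ.2.1))
  else 0

/-- **The K-table test**: `Σ_{i₁ i₂} Σ_{μ ∈ shifts} lipTermQ ≤ K` at every window target. [folklore] -/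
def checkLipT (m : ℕ) (Kb Ka : ℤ) (shifts : List (ℤ × ℤ × ℤ)) (coefB : Fin m → ℤ → Fin m → Fin m → ℤ × ℤ × ℤ → IntervalD)
    (loD hiD : Array Dyad) (K : ℚ) : Bool :=
  (List.finRange m).all fun i => (List.range (winLen Kb Ka)).all fun c =>
    decide (∑ i₁ : Fin m, ∑ i₂ : Fin m, ∑ μ ∈ shifts.toFinset, lipTermQ Kb Ka coefB loD hiD i ((c : ℤ) - Kb) i₁ i₂ μ ≤ K)

/-- **`PFieldLipOn` ON THE WEIGHTED BOX FROM THE K-TABLE TEST** (glue XV-c `pfieldLipOn_of_table`). [folklore] -/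
theorem pfieldLip_of_checkLipT {ω : Fin m → ℤ → ℝ} {ε₀ : ℝ} {α : Fin m → Fin m → Fin m → ℤ × ℤ × ℤ → ℝ} {shifts : List (ℤ × ℤ × ℤ)}
    {coefB : Fin m → ℤ → Fin m → Fin m → ℤ × ℤ × ℤ → IntervalD} (hKb : 0 ≤ Kb) (hKa : 1 ≤ Ka) (hω : ∀ i k, 0 < ω i k)
    (hε : 0 < 1 + ε₀) (hcoef : CoefBoxOK shifts ε₀ α Kb Ka ω coefB) {loD hiD : Array Dyad} {K : ℚ}
    (h : checkLipT m Kb Ka shifts coefB loD hiD K = true) :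
    PFieldLipOn shifts.toFinset ε₀ α Kb Ka ω (wbox Kb Ka ω loD) (wbox Kb Ka ω hiD) (K : ℝ) := by
  refine pfieldLipOn_of_table hε (fun i k => (hω i k).le) fun i k hk1 hk2 => ?_
  simp only [checkLipT, List.all_eq_true, List.mem_finRange, List.mem_range, decide_eq_true_eq, true_implies] at h
  have hc : (k + Kb).toNat < winLen Kb Ka := by
    unfold winLen; rw [Int.toNat_lt_toNat (by omega)]; omega
  have hrow := h i (k + Kb).toNat hc
  rw [Int.toNat_of_nonneg (by omega), show k + Kb - Kb = k by ring] at hrow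
  have hrow' : ((∑ i₁ : Fin m, ∑ i₂ : Fin m, ∑ μ ∈ shifts.toFinset, lipTermQ Kb Ka coefB loD hiD i k i₁ i₂ μ : ℚ) : ℝ) ≤ (K : ℝ) := by
    exact_mod_cast hrow
  push_cast at hrow'
  -- termwise
  have hterm : ∀ (i₁ i₂ : Fin m) (μ : ℤ × ℤ × ℤ), μ ∈ shifts →
      |α i₁ i₂ i μ| * (1 + ε₀) ^ ((5 : ℝ) * (k - μ.2.2) / 2) *
          (boxSup Kb Ka (wbox Kb Ka ω loD) (wbox Kb Ka ω hiD) i₁ (k - μ.2.2 + μ.1) * pwExt Kb Ka ω i₂ (k - μ.2.2 + μ.2.1) +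
            pwExt Kb Ka ω i₁ (k - μ.2.2 + μ.1) * boxSup Kb Ka (wbox Kb Ka ω loD) (wbox Kb Ka ω hiD) i₂ (k - μ.2.2 + μ.2.1)) ≤
        ω i k * (lipTermQ Kb Ka coefB loD hiD i k i₁ i₂ μ : ℝ) := by
    intro i₁ i₂ μ hμ
    by_cases ha : -Kb ≤ k - μ.2.2 + μ.1 ∧ k - μ.2.2 + μ.1 ≤ Ka
    · by_cases hb : -Kb ≤ k - μ.2.2 + μ.2.1 ∧ k - μ.2.2 + μ.2.1 ≤ Ka
      · have hmag := IntervalD.abs_le_mag (hcoef i k i₁ i₂ μ hμ hk1 hk2)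
        have hc0 : 0 < (1 + ε₀) ^ ((5 : ℝ) * (k - μ.2.2) / 2) := Real.rpow_pos_of_pos hε _
        set g1 := (gOf loD hiD (idxOf Kb Ka i₁ (k - μ.2.2 + μ.1) ha)).toReal with hg1d
        set g2 := (gOf loD hiD (idxOf Kb Ka i₂ (k - μ.2.2 + μ.2.1) hb)).toReal with hg2d
        have hg1 : 0 ≤ g1 := gOf_nonneg _ _ _
        have hg2 : 0 ≤ g2 := gOf_nonneg _ _ _
        have hlt : (lipTermQ Kb Ka coefB loD hiD i k i₁ i₂ μ : ℝ) = (IntervalD.mag (coefB i k i₁ i₂ μ)).toReal * (g1 + g2) := by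
          simp only [lipTermQ, if_pos (And.intro ha hb), gTab, dif_pos ha, dif_pos hb]
          push_cast
          rw [cast_dyadToRat, cast_dyadToRat, cast_dyadToRat]
        rw [hlt, boxSup_wbox hω loD hiD i₁ ha, boxSup_wbox hω loD hiD i₂ hb]
        simp only [pwExt, if_pos ha, if_pos hb]
        have hval : |α i₁ i₂ i μ| * (1 + ε₀) ^ ((5 : ℝ) * (k - μ.2.2) / 2) *
            (ω i₁ (k - μ.2.2 + μ.1) * g1 * ω i₂ (k - μ.2.2 + μ.2.1) + ω i₁ (k - μ.2.2 + μ.1) * (ω i₂ (k - μ.2.2 + μ.2.1) * g2)) =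
            ω i k * (|pcoef ε₀ α ω i k i₁ i₂ μ| * (g1 + g2)) := by
          have hne : ω i k ≠ 0 := (hω i k).ne'
          unfold pcoef
          rw [abs_mul, abs_mul, abs_of_pos hc0, abs_div, abs_of_pos (hω i k), abs_mul, abs_of_pos (hω i₁ _), abs_of_pos (hω i₂ _)]
          field_simp
        rw [hval]
        exact mul_le_mul_of_nonneg_left (mul_le_mul_of_nonneg_right hmag (add_nonneg hg1 hg2)) (hω i k).le
      · have hcond : ¬((-Kb ≤ k - μ.2.2 + μ.1 ∧ k - μ.2.2 + μ.1 ≤ Ka) ∧ (-Kb ≤ k - μ.2.2 + μ.2.1 ∧ k - μ.2.2 + μ.2.1 ≤ Ka)) :=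
          fun h => hb h.2
        have hz : (lipTermQ Kb Ka coefB loD hiD i k i₁ i₂ μ : ℝ) = 0 := by
          simp [lipTermQ, hcond]
        rw [hz, mul_zero]
        simp [pwExt, boxSup, wbox, hb]
    · have hcond : ¬((-Kb ≤ k - μ.2.2 + μ.1 ∧ k - μ.2.2 + μ.1 ≤ Ka) ∧ (-Kb ≤ k - μ.2.2 + μ.2.1 ∧ k - μ.2.2 + μ.2.1 ≤ Ka)) :=
        fun h => ha h.1
      have hz : (lipTermQ Kb Ka coefB loD hiD i k i₁ i₂ μ : ℝ) = 0 := by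
        simp [lipTermQ, hcond]
      rw [hz, mul_zero]
      simp [pwExt, boxSup, wbox, ha]
  calc _ ≤ ∑ i₁ : Fin m, ∑ i₂ : Fin m, ∑ μ ∈ shifts.toFinset, ω i k * (lipTermQ Kb Ka coefB loD hiD i k i₁ i₂ μ : ℝ) :=
        Finset.sum_le_sum fun i₁ _ => Finset.sum_le_sum fun i₂ _ => Finset.sum_le_sum fun μ hμ =>
          hterm i₁ i₂ μ (List.mem_toFinset.mp hμ)
    _ = ω i k * ∑ i₁ : Fin m, ∑ i₂ : Fin m, ∑ μ ∈ shifts.toFinset, (lipTermQ Kb Ka coefB loD hiD i k i₁ i₂ μ : ℝ) := by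
        simp only [Finset.mul_sum]
    _ ≤ ω i k * (K : ℝ) := mul_le_mul_of_nonneg_left hrow' (hω i k).le
    _ = (K : ℝ) * ω i k := mul_comm _ _

/-! ### The δ-table on the weighted box -/

/-- The rational edge-extended sup profile of the weighted box: `g · ωq` on the window, `Eb` / `Et` at the edge shells, `0` beyond. [folklore] -/
def gSupT (Kb Ka : ℤ) (Eb Et : ℚ) (ωq : Fin m → ℤ → ℚ) (loD hiD : Array Dyad) (i : Fin m) (n : ℤ) : ℚ :=
  if -Kb ≤ n ∧ n ≤ Ka then gTab Kb Ka loD hiD i n * ωq i n else if n = -Kb - 1 then Eb else if n = Ka + 1 then Et else 0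

/-- `gSupT` is the `boxSupIn` of the weighted box with edge bounds. [folklore] -/
theorem boxSupIn_wbox_eq {Eb Et : ℚ} {ωq : Fin m → ℤ → ℚ} (hω : ∀ i k, 0 < ωq i k) (loD hiD : Array Dyad) (i : Fin m) (n : ℤ) :
    boxSupIn Kb Ka (Eb : ℝ) (Et : ℝ) (wbox Kb Ka (fun i k => (ωq i k : ℝ)) loD) (wbox Kb Ka (fun i k => (ωq i k : ℝ)) hiD) i n =
      (gSupT Kb Ka Eb Et ωq loD hiD i n : ℝ) := by
  have hω' : ∀ i k, (0 : ℝ) < (ωq i k : ℝ) := fun i k => by exact_mod_cast hω i k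
  unfold boxSupIn gSupT
  by_cases hn : -Kb ≤ n ∧ n ≤ Ka
  · rw [if_pos hn, if_pos hn]
    have := boxSup_wbox (Kb := Kb) (Ka := Ka) hω' loD hiD i hn
    unfold boxSup at this
    rw [if_pos hn] at this
    rw [this]
    simp only [gTab, dif_pos hn]
    push_cast
    rw [cast_dyadToRat, mul_comm]
  · rw [if_neg hn, if_neg hn]
    split_ifs <;> push_cast <;> rfl

/-- The box of one off-window monomial of the defect sum at target `(i,k)` on the weighted box, divided by `ω i k`. [folklore] -/
def dtermBoxT (Kb Ka : ℤ) (prec : ℕ) (αq : Fin m → Fin m → Fin m → ℤ × ℤ × ℤ → ℚ) (ωq : Fin m → ℤ → ℚ) (Eb Et : ℚ)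
    (loD hiD : Array Dyad) (Sp Sm : IntervalD) (i : Fin m) (k : ℤ) (i₁ i₂ : Fin m) (μ : ℤ × ℤ × ℤ) : IntervalD :=
  if (-Kb ≤ k - μ.2.2 + μ.1 ∧ k - μ.2.2 + μ.1 ≤ Ka) ∧ (-Kb ≤ k - μ.2.2 + μ.2.1 ∧ k - μ.2.2 + μ.2.1 ≤ Ka) then IntervalD.ofInt 0
  else IntervalD.mulR prec
    (ofRatRel prec (|αq i₁ i₂ i μ| * (gSupT Kb Ka Eb Et ωq loD hiD i₁ (k - μ.2.2 + μ.1) *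
      gSupT Kb Ka Eb Et ωq loD hiD i₂ (k - μ.2.2 + μ.2.1) / ωq i k)))
    (clockBox prec Sp Sm (k - μ.2.2))

/-- Exact dyadic sum of the defect-term magnitudes at target `(i, k)` on the weighted box. [folklore] -/
def dRowSumT (Kb Ka : ℤ) (prec : ℕ) (shifts : List (ℤ × ℤ × ℤ)) (αq : Fin m → Fin m → Fin m → ℤ × ℤ × ℤ → ℚ)
    (ωq : Fin m → ℤ → ℚ) (Eb Et : ℚ) (loD hiD : Array Dyad) (Sp Sm : IntervalD) (i : Fin m) (k : ℤ) : Dyad :=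
  (List.finRange m).foldr (fun i₁ acc₁ => Dyad.add ((List.finRange m).foldr (fun i₂ acc₂ => Dyad.add
    (shifts.foldr (fun μ acc₃ => Dyad.add (IntervalD.mag (dtermBoxT Kb Ka prec αq ωq Eb Et loD hiD Sp Sm i k i₁ i₂ μ)) acc₃)
      (Dyad.ofInt 0)) acc₂) (Dyad.ofInt 0)) acc₁) (Dyad.ofInt 0)

/-- **The defect test on the weighted box**: `dRowSumT ≤ δ` at every window target. [folklore] -/
def checkDefectT (m : ℕ) (Kb Ka : ℤ) (prec : ℕ) (shifts : List (ℤ × ℤ × ℤ)) (αq : Fin m → Fin m → Fin m → ℤ × ℤ × ℤ → ℚ)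
    (ωq : Fin m → ℤ → ℚ) (Eb Et : ℚ) (loD hiD : Array Dyad) (Sp Sm : IntervalD) (δ : Dyad) : Bool :=
  (List.finRange m).all fun i => (List.range (winLen Kb Ka)).all fun c =>
    Dyad.ble (dRowSumT Kb Ka prec shifts αq ωq Eb Et loD hiD Sp Sm i ((c : ℤ) - Kb)) δ

/-- The value of `dRowSumT` as a triple sum. [folklore] -/
theorem toReal_dRowSumT {prec : ℕ} {shifts : List (ℤ × ℤ × ℤ)} (hnd : shifts.Nodup) {αq : Fin m → Fin m → Fin m → ℤ × ℤ × ℤ → ℚ}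
    {ωq : Fin m → ℤ → ℚ} {Eb Et : ℚ} {loD hiD : Array Dyad} {Sp Sm : IntervalD} (i : Fin m) (k : ℤ) :
    (dRowSumT Kb Ka prec shifts αq ωq Eb Et loD hiD Sp Sm i k).toReal =
      ∑ i₁ : Fin m, ∑ i₂ : Fin m, ∑ μ ∈ shifts.toFinset,
        (IntervalD.mag (dtermBoxT Kb Ka prec αq ωq Eb Et loD hiD Sp Sm i k i₁ i₂ μ)).toReal := by
  unfold dRowSumT
  rw [toReal_foldr_add, Fin.sum_univ_def]
  refine congrArg List.sum (List.map_congr_left fun i₁ _ => ?_)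
  rw [toReal_foldr_add, Fin.sum_univ_def]
  refine congrArg List.sum (List.map_congr_left fun i₂ _ => ?_)
  rw [toReal_foldr_add, List.sum_toFinset _ hnd]

/-- One term of the defect sum on the weighted box is bounded by `ω i k · mag(dtermBoxT)`. [folklore] -/
theorem dtermT_le {prec : ℕ} {q : ℚ} (hq : 0 < 1 + (q : ℝ)) {αq : Fin m → Fin m → Fin m → ℤ × ℤ × ℤ → ℚ} {ωq : Fin m → ℤ → ℚ}
    (hω : ∀ i k, 0 < ωq i k) {Eb Et : ℚ} {loD hiD : Array Dyad} {Sp Sm : IntervalD} (hSp : sqrtCheck prec (1 + q) Sp = true)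
    (hSm : sqrtCheck prec (1 / (1 + q)) Sm = true) (i : Fin m) (k : ℤ) (i₁ i₂ : Fin m) (μ : ℤ × ℤ × ℤ) :
    |(αq i₁ i₂ i μ : ℝ)| * (1 + (q : ℝ)) ^ ((5 : ℝ) * (k - μ.2.2) / 2) *
        (if (-Kb ≤ k - μ.2.2 + μ.1 ∧ k - μ.2.2 + μ.1 ≤ Ka) ∧ (-Kb ≤ k - μ.2.2 + μ.2.1 ∧ k - μ.2.2 + μ.2.1 ≤ Ka) then 0
          else boxSupIn Kb Ka (Eb : ℝ) (Et : ℝ) (wbox Kb Ka (fun i k => (ωq i k : ℝ)) loD) (wbox Kb Ka (fun i k => (ωq i k : ℝ)) hiD) i₁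
              (k - μ.2.2 + μ.1) *
            boxSupIn Kb Ka (Eb : ℝ) (Et : ℝ) (wbox Kb Ka (fun i k => (ωq i k : ℝ)) loD) (wbox Kb Ka (fun i k => (ωq i k : ℝ)) hiD) i₂
              (k - μ.2.2 + μ.2.1)) ≤
      (ωq i k : ℝ) * (IntervalD.mag (dtermBoxT Kb Ka prec αq ωq Eb Et loD hiD Sp Sm i k i₁ i₂ μ)).toReal := by
  unfold dtermBoxT
  by_cases hw : (-Kb ≤ k - μ.2.2 + μ.1 ∧ k - μ.2.2 + μ.1 ≤ Ka) ∧ (-Kb ≤ k - μ.2.2 + μ.2.1 ∧ k - μ.2.2 + μ.2.1 ≤ Ka)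
  · have h0 : (IntervalD.mag (IntervalD.ofInt 0)).toReal = 0 := by
      simp [IntervalD.mag, IntervalD.ofInt, IntervalD.ofDyad, Dyad.toReal_max, Dyad.toReal_abs]
    rw [if_pos hw, if_pos hw, mul_zero, h0, mul_zero]
  · rw [if_neg hw, if_neg hw, boxSupIn_wbox_eq hω, boxSupIn_wbox_eq hω]
    have hp : IntervalD.mem (Real.sqrt (1 + (q : ℝ))) Sp := by
      have := mem_sqrt_of_sqrtCheck hSp; push_cast at this; exact this
    have hm : IntervalD.mem (Real.sqrt (1 + (q : ℝ))⁻¹) Sm := by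
      have := mem_sqrt_of_sqrtCheck hSm; push_cast at this; rwa [one_div] at this
    have hmem : IntervalD.mem
        (((|αq i₁ i₂ i μ| * (gSupT Kb Ka Eb Et ωq loD hiD i₁ (k - μ.2.2 + μ.1) * gSupT Kb Ka Eb Et ωq loD hiD i₂ (k - μ.2.2 + μ.2.1) /
            ωq i k) : ℚ) : ℝ) * (1 + (q : ℝ)) ^ ((5 : ℝ) * ((k - μ.2.2 : ℤ) : ℝ) / 2))
        (IntervalD.mulR prec (ofRatRel prec (|αq i₁ i₂ i μ| * (gSupT Kb Ka Eb Et ωq loD hiD i₁ (k - μ.2.2 + μ.1) *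
          gSupT Kb Ka Eb Et ωq loD hiD i₂ (k - μ.2.2 + μ.2.1) / ωq i k))) (clockBox prec Sp Sm (k - μ.2.2))) :=
      IntervalD.mem_mulR prec (mem_ofRatRel prec _) (mem_clockBox prec hq hp hm (k - μ.2.2))
    have hle := IntervalD.abs_le_mag hmem
    have hωk : (0 : ℝ) < (ωq i k : ℝ) := by exact_mod_cast hω i k
    have hval : |(αq i₁ i₂ i μ : ℝ)| * (1 + (q : ℝ)) ^ ((5 : ℝ) * (k - μ.2.2) / 2) *
        ((gSupT Kb Ka Eb Et ωq loD hiD i₁ (k - μ.2.2 + μ.1) : ℝ) * (gSupT Kb Ka Eb Et ωq loD hiD i₂ (k - μ.2.2 + μ.2.1) : ℝ)) =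
        (ωq i k : ℝ) * ((((|αq i₁ i₂ i μ| * (gSupT Kb Ka Eb Et ωq loD hiD i₁ (k - μ.2.2 + μ.1) *
          gSupT Kb Ka Eb Et ωq loD hiD i₂ (k - μ.2.2 + μ.2.1) / ωq i k) : ℚ) : ℝ)) *
          (1 + (q : ℝ)) ^ ((5 : ℝ) * ((k - μ.2.2 : ℤ) : ℝ) / 2)) := by
      push_cast
      field_simp
    rw [hval]
    exact mul_le_mul_of_nonneg_left ((le_abs_self _).trans hle) hωk.le

/-- **`hdef` ON THE WEIGHTED BOX FROM THE TEST**: `checkDefectT = true` ⇒ `PInputDefectOn` on the box `[wbox lo, wbox hi]` with edge bounds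
(nearest-neighbour `𝕊 = shifts.toFinset`, rational data, `δ := δ.toReal`). [cite: Tao2016AveragedNS, §4 (4.8); cell certificate format, checker clauses] -/
theorem pinputDefect_of_checkDefectT (prec : ℕ) {shifts : List (ℤ × ℤ × ℤ)} (hnd : shifts.Nodup) (h𝕊 : IsNearestNeighbourSet shifts.toFinset)
    {q : ℚ} (hq : 0 < 1 + (q : ℝ)) {αq : Fin m → Fin m → Fin m → ℤ × ℤ × ℤ → ℚ} {ωq : Fin m → ℤ → ℚ} (hω : ∀ i k, 0 < ωq i k)
    {Eb Et : ℚ} {loD hiD : Array Dyad} {Sp Sm : IntervalD} (hSp : sqrtCheck prec (1 + q) Sp = true)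
    (hSm : sqrtCheck prec (1 / (1 + q)) Sm = true) {δ : Dyad}
    (h : checkDefectT m Kb Ka prec shifts αq ωq Eb Et loD hiD Sp Sm δ = true) :
    PInputDefectOn shifts.toFinset (q : ℝ) (fun i₁ i₂ i μ => (αq i₁ i₂ i μ : ℝ)) Kb Ka (Eb : ℝ) (Et : ℝ) (fun i k => (ωq i k : ℝ))
      (wbox Kb Ka (fun i k => (ωq i k : ℝ)) loD) (wbox Kb Ka (fun i k => (ωq i k : ℝ)) hiD) δ.toReal := by
  refine pinputDefectOn_of_table h𝕊 hq fun i k hk1 hk2 => ?_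
  simp only [checkDefectT, List.all_eq_true, List.mem_finRange, List.mem_range, Dyad.ble_iff, true_implies] at h
  have hc : (k + Kb).toNat < winLen Kb Ka := by
    unfold winLen; rw [Int.toNat_lt_toNat (by omega)]; omega
  have hrow := h i (k + Kb).toNat hc
  rw [Int.toNat_of_nonneg (by omega), show k + Kb - Kb = k by ring, toReal_dRowSumT hnd] at hrow
  have hωk : (0 : ℝ) < (ωq i k : ℝ) := by exact_mod_cast hω i k
  calc _ ≤ ∑ i₁ : Fin m, ∑ i₂ : Fin m, ∑ μ ∈ shifts.toFinset,
          (ωq i k : ℝ) * (IntervalD.mag (dtermBoxT Kb Ka prec αq ωq Eb Et loD hiD Sp Sm i k i₁ i₂ μ)).toReal :=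
        Finset.sum_le_sum fun i₁ _ => Finset.sum_le_sum fun i₂ _ => Finset.sum_le_sum fun μ _ => by
          simpa [Rat.cast_abs] using dtermT_le (Kb := Kb) (Ka := Ka) hq hω (loD := loD) (hiD := hiD) hSp hSm i k i₁ i₂ μ
    _ = (ωq i k : ℝ) * ∑ i₁ : Fin m, ∑ i₂ : Fin m, ∑ μ ∈ shifts.toFinset,
          (IntervalD.mag (dtermBoxT Kb Ka prec αq ωq Eb Et loD hiD Sp Sm i k i₁ i₂ μ)).toReal := by simp only [Finset.mul_sum]
    _ ≤ (ωq i k : ℝ) * δ.toReal := mul_le_mul_of_nonneg_left hrow hωk.le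
    _ = δ.toReal * (ωq i k : ℝ) := mul_comm _ _

/-! ### Grönwall with a general constant -/

/-- **The Grönwall test with a general constant `K > 0`**: `δ ≥ 0`, `h ≥ 0`, `Kh ≤ 2^k`, `n > 0`, `(δ/K)(expUpperHalvedQ (Kh) k n − 1) ≤ A`.
[folklore] -/
def checkGronwallK (K δ h A : ℚ) (k n : ℕ) : Bool :=
  decide (0 < K) && decide (0 ≤ δ) && decide (0 ≤ h) && decide (K * h / 2 ^ k ≤ 1) && decide (0 < n) &&
    decide (δ / K * (expUpperHalvedQ (K * h) k n - 1) ≤ A)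

/-- `gronwallBound 0 K δ h ≤ A` from the test. [folklore] -/
theorem gronwallK_of_check {K δ h A : ℚ} {k n : ℕ} (hc : checkGronwallK K δ h A k n = true) :
    gronwallBound 0 (K : ℝ) (δ : ℝ) (h : ℝ) ≤ (A : ℝ) := by
  simp only [checkGronwallK, Bool.and_eq_true, decide_eq_true_eq] at hc
  obtain ⟨⟨⟨⟨⟨hK, hδ⟩, hh⟩, hk⟩, hn⟩, hA⟩ := hc
  have hKr : (0 : ℝ) < (K : ℝ) := by exact_mod_cast hK
  rw [gronwallBound_of_K_ne_0 hKr.ne']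
  simp only [zero_mul, zero_add]
  have hexp := exp_le_expUpperHalvedQ (y := K * h) (by positivity) hk hn
  have hA' : ((δ / K * (expUpperHalvedQ (K * h) k n - 1) : ℚ) : ℝ) ≤ (A : ℝ) := by exact_mod_cast hA
  push_cast at hA' hexp
  have hdK : (0 : ℝ) ≤ (δ : ℝ) / (K : ℝ) := div_nonneg (by exact_mod_cast hδ) hKr.le
  calc (δ : ℝ) / (K : ℝ) * (Real.exp ((K : ℝ) * (h : ℝ)) - 1)
      ≤ (δ : ℝ) / (K : ℝ) * (((expUpperHalvedQ (K * h) k n : ℚ) : ℝ) - 1) := mul_le_mul_of_nonneg_left (by linarith) hdK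
    _ ≤ (A : ℝ) := hA'

end CertificateGlueOn

end Summit.NavierStokesRegularity.NavierStokesRegularity.Theorems
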